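import Mathlib
import Summits.AnomalousDissipation.AnomalousDissipation.Theses.DyadicWallCascade
import Summits.NavierStokesRegularity.NavierStokesRegularity.Theorems.LiouvilleConjectureNS
import Literature.Uncategorized.SteadyNSRealAnalytic
import Literature.Analysis.FluidPDE.SteadyNSBoundedMild
import Literature.Analysis.FluidPDE.KNSSTypeIRateLiouvilleMild
import Literature.Analysis.FluidPDE.NSBoundedMildSmoothing

/-!
# `LiouvilleConjectureNS → ¬ DyadicWallCascade.ViscousWallProfile`
# — the antecedent of the crux `DyadicRealisation` is a counterexample to the KNSS Liouville conjecture
# (negative lemma, crux stmt-AnomalousDissipation-17918; support stmt-AnomalousDissipation-17919)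

Refuter file, Negative lane (D-0016), route `DyadicWallCascade` of `Summits/AnomalousDissipation`,
sub-problem `AnomalousDissipation`; disprover seat `cdisprove-stmt-AnomalousDissipation-17918`.

The crux `DyadicRealisation` (stmt-17918, rev 2) is by `rfl` the implication
`ViscousWallProfile → CoherentStates.SteadyZerothLaw`: its antecedent is, verbatim, the route's
support statement `ViscousWallProfile` (stmt-17919) — a bounded `C^∞` mirror-symmetric force-free
steady Navier–Stokes flow `(W, P)` on `ℝ³` at unit viscosity with bounded pressure whose dyadic
blow-downs `(W, P)(2^m ·)` converge uniformly on the band `1 ≤ X₂ ≤ 2` to a half-space hierarchy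
`(V, Q)` with zero mass flux and NON-ZERO energy flux `F` through the unit square of `X₂ = 1`.

This file kernel-checks the route's own kill criterion ("a Liouville theorem for bounded force-free
steady Navier–Stokes flows on ℝ³ — the steady case of the bounded-ancient-solution conjecture of
Koch–Nadirashvili–Seregin–Šverák — refutes ViscousWallProfile") against the tree's CANONICAL
statement of that conjecture, `Summit.NavierStokesRegularity.NavierStokesRegularity.LiouvilleConjectureNS`
(KNSS 2009 §1, conjecture (L): every bounded ancient mild solution is spatially constant on every
slice), including the one non-trivial bridge the informal criterion hides:

1. `isBoundedAncientMildSolution_of_steadyClauses` — a velocity-bounded `C^∞` solution of the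
   clause-form stationary system (`∑ᵢ (DW eᵢ)ᵢ = 0`, `DW(W) + ∇P = ∑ᵢ D(DW eᵢ) eᵢ`), viewed as the
   constant-in-time family `t ↦ W`, IS a bounded ancient mild solution in the tree's duality
   sense (`IsBoundedAncientMildSolution 1`).  Ingredients, all accepted tree theorems: the clause
   form is the steady classical system (`isSteadyClassicalNS_of_clauses`); bounded steady flows
   solve Oseen's integral equation from their own datum, `W = e^{τΔ}W − B¹₀(W,W)(τ)`
   (`IsSteadyClassicalNS.eq_heatExtension_sub_oseenDuhamel`, KNSS 2009 Lemma 3.1 + steady drift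
   kill); Oseen-mild bounded continuous ancient fields are duality-mild
   (`isBoundedAncientMildSolution_of_oseen`, Lemarié-Rieusset 2016 Thm 6.1); time translation of
   the Duhamel term (`oseenDuhamel_translate`); smooth solenoidal fields are weakly solenoidal
   (`VectorCalculus.IsDivFree.isWeaklyDivFree_holds`).  No pressure bound, mirror symmetry or
   blow-down structure is used: EVERY velocity-bounded smooth entire steady flow is in the KNSS class.
2. `const_of_liouvilleConjectureNS` — hence, modulo (L), such a `W` is constant (a.e. constant
   slice + continuity, `Continuous.ae_eq_iff_eq`).
3. `flux_eq_zero_of_const_blowdown` — a constant profile blows down to a field that is constant on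
   the band; the zero-mass-flux clause kills its vertical component on `X₂ = 1` and with it the
   energy-flux integrand: `F = 0` (H-free; the degenerate-model lemma of refuter rattack-17918,
   `const_profile_forces_F_zero`, here in reusable form).
4. `ViscousWallProfile_false_of_LiouvilleConjectureNS` — 2 + 3 contradict the clause `F ≠ 0`.

Consequences for the crux and the route (corollary 5, pure logic; the second is NOT stated as a
theorem, to keep the negative-knowledge index free of a conditional edge on crux #2):
* `LiouvilleConjectureNS_false_of_not_DyadicRealisation`: ANY disproof of the crux stmt-17918
  refutes the KNSS Liouville conjecture (it must exhibit the profile, i.e. a non-constant bounded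
  entire steady flow) — besides proving the steady negative `¬SteadyZerothLaw` for every force.
  This is why the crux resists disproof: `¬DyadicRealisation ↔ ViscousWallProfile ∧ ¬SteadyZerothLaw`,
  the first conjunct is `¬(L)`-hard, the second is the negation of the summit-level item stmt-0219.
* (remark) modulo (L) the cruxes #2 and #3 of the route are jointly unsatisfiable
  (`ViscousContinuation` is `HalfSpaceHierarchy → ⟨ViscousWallProfile block⟩`, so under (L) it
  yields `¬HalfSpaceHierarchy`: `fun h₂ => ViscousWallProfile_false_of_LiouvilleConjectureNS hL (h₃ h₂)`),
  and `closes h₂ h₃ h₄` can only ever be instantiated if (L) FAILS for a steady, mirror-symmetric,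
  pressure-bounded flow.  The route is a bet against the steady case of
  (L); this file makes the bet explicit and checkable, it does not settle it ((L) is open:
  KNSS 2009 prove the 2-D and the axisymmetric no-swirl cases, Thms 5.1–5.2).

Classification: NOT a refutation of any item (H = (L) is an open conjecture, not constructible);
negative lemma for the disprover's ledger of stmt-17918 and for the attackers of stmt-17919/17917.

## References

* [KochNadirashviliSereginSverak2009] G. Koch, N. Nadirashvili, G. Seregin, V. Šverák, *Liouville
  theorems for the Navier–Stokes equations and applications*, Acta Math. 203 (2009) 83–105
  (arXiv:0709.3599), §1 conjecture (L), Lemma 3.1, Thms 5.1–5.2.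
* [LemarieRieusset2016] P. G. Lemarié-Rieusset, *The Navier–Stokes Problem in the 21st Century*,
  CRC Press 2016, Thm 6.1 (Oseen solutions), Thm 9.12.
-/

open scoped BigOperators Topology
open Filter Set MeasureTheory Function

-- `Summit.<Summit>.<Problem>` is the tree's mandated summit-side namespace (CONVENTIONS §2); for this
-- single-conjunct summit the two coincide, so the duplicate is deliberate.
set_option linter.dupNamespace false

namespace Summit.AnomalousDissipation.AnomalousDissipation.Theorems

namespace DyadicWallCascadeNegative

open Literature.Analysis.FluidPDE Literature.Uncategorized

/-- **Bridge: velocity-bounded smooth entire steady Navier–Stokes flows are bounded ancient mild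
solutions.**  A `C^∞` pair `(W, P)` on `ℝ³` solving the clause-form stationary system at unit
viscosity without force, with `‖W‖ ≤ C'`, gives the constant-in-time family `t ↦ W`, which is a
bounded ancient mild solution in duality form (`IsBoundedAncientMildSolution 1`, the class of the
KNSS Liouville conjecture).  Proof: Oseen representation of bounded steady flows
(`IsSteadyClassicalNS.eq_heatExtension_sub_oseenDuhamel`) + `isBoundedAncientMildSolution_of_oseen`.
[folklore] -/
theorem isBoundedAncientMildSolution_of_steadyClauses
    {W : EuclideanSpace ℝ (Fin 3) → EuclideanSpace ℝ (Fin 3)} {P : EuclideanSpace ℝ (Fin 3) → ℝ}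
    {C' : ℝ}
    (hWs : ContDiff ℝ ((⊤ : ℕ∞) : WithTop ℕ∞) W) (hPs : ContDiff ℝ ((⊤ : ℕ∞) : WithTop ℕ∞) P)
    (hWb : ∀ X, ‖W X‖ ≤ C')
    (hWdiv : ∀ X, ∑ i : Fin 3, (fderiv ℝ W X (EuclideanSpace.single i (1 : ℝ))) i = 0)
    (hNS : ∀ X, (fderiv ℝ W X) (W X) + gradient P X =
      ∑ i : Fin 3, fderiv ℝ (fun Y => fderiv ℝ W Y (EuclideanSpace.single i (1 : ℝ))) X
        (EuclideanSpace.single i (1 : ℝ))) :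
    IsBoundedAncientMildSolution 1 (fun _ : ℝ => W) := by
  have h : IsSteadyClassicalNS 1 0 W P := isSteadyClassicalNS_of_clauses hWs hPs hWdiv hNS
  have hWc : Continuous W := hWs.continuous
  refine isBoundedAncientMildSolution_of_oseen one_pos ?_ ⟨C', fun _ _ X => hWb X⟩ ?_ ?_
  · exact (hWc.comp continuous_snd).continuousOn
  · intro t _
    exact VectorCalculus.IsDivFree.isWeaklyDivFree_holds h.divFree
      (hWs.of_le (by exact_mod_cast le_top))
  · intro s t hst _ x
    rw [one_mul, h.eq_heatExtension_sub_oseenDuhamel hWb (sub_pos.2 hst) x]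
    have h2 := oseenDuhamel_translate 1 0 s (fun _ : ℝ => W) (fun _ : ℝ => W) (t - s) x
    simp only [zero_add, sub_add_cancel] at h2
    rw [h2]

/-- **Modulo the KNSS Liouville conjecture, velocity-bounded smooth entire steady flows are
constant** (the steady case of (L): the slice at `t = -1` of the constant family is a.e. constant,
and `W` is continuous). [folklore] -/
theorem const_of_liouvilleConjectureNS
    (hL : Summit.NavierStokesRegularity.NavierStokesRegularity.LiouvilleConjectureNS)
    {W : EuclideanSpace ℝ (Fin 3) → EuclideanSpace ℝ (Fin 3)} {P : EuclideanSpace ℝ (Fin 3) → ℝ}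
    {C' : ℝ}
    (hWs : ContDiff ℝ ((⊤ : ℕ∞) : WithTop ℕ∞) W) (hPs : ContDiff ℝ ((⊤ : ℕ∞) : WithTop ℕ∞) P)
    (hWb : ∀ X, ‖W X‖ ≤ C')
    (hWdiv : ∀ X, ∑ i : Fin 3, (fderiv ℝ W X (EuclideanSpace.single i (1 : ℝ))) i = 0)
    (hNS : ∀ X, (fderiv ℝ W X) (W X) + gradient P X =
      ∑ i : Fin 3, fderiv ℝ (fun Y => fderiv ℝ W Y (EuclideanSpace.single i (1 : ℝ))) X
        (EuclideanSpace.single i (1 : ℝ))) :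
    ∃ b : EuclideanSpace ℝ (Fin 3), ∀ X, W X = b := by
  have hmild := isBoundedAncientMildSolution_of_steadyClauses hWs hPs hWb hWdiv hNS
  have hWc : Continuous W := hWs.continuous
  obtain ⟨b, hb⟩ := hL (fun _ : ℝ => W) hmild (fun _ _ => hWc.aestronglyMeasurable) (-1)
    (by norm_num)
  refine ⟨b, fun X => ?_⟩
  have hWeq : W = fun _ => b := (Continuous.ae_eq_iff_eq volume hWc continuous_const).1 hb
  exact congrFun hWeq X

/-- **A constant profile blows down to a flux-free field (H-free).**  If `W ≡ b` and the dyadic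
blow-downs `W (2^m • X)` converge uniformly on the band `1 ≤ X₂ ≤ 2` to `V`, then `V ≡ b` on the
band; zero mass flux through the unit square of `X₂ = 1` forces `b₂ = 0`, so the energy flux
`∫ V₂ (|V|²/2 + Q)` through that square vanishes: `F = 0`, for ANY `Q`.  (The degenerate model
`W ≡ c` of the antecedent: the clause `F ≠ 0` is exactly what excludes it.) [folklore] -/
theorem flux_eq_zero_of_const_blowdown
    {W V : EuclideanSpace ℝ (Fin 3) → EuclideanSpace ℝ (Fin 3)} {Q : EuclideanSpace ℝ (Fin 3) → ℝ}
    {F : ℝ} {b : EuclideanSpace ℝ (Fin 3)} (hW : ∀ X, W X = b)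
    (hbd : ∀ ε : ℝ, 0 < ε → ∃ M : ℕ, ∀ m : ℕ, M ≤ m → ∀ X : EuclideanSpace ℝ (Fin 3),
      1 ≤ X 2 → X 2 ≤ 2 → ‖W ((2 : ℝ) ^ m • X) - V X‖ ≤ ε)
    (hmass : ∫ q in Set.Icc (0 : ℝ) 1 ×ˢ Set.Icc (0 : ℝ) 1, (V !₂[q.1, q.2, (1 : ℝ)]) 2 = 0)
    (hflux : ∫ q in Set.Icc (0 : ℝ) 1 ×ˢ Set.Icc (0 : ℝ) 1,
      (V !₂[q.1, q.2, (1 : ℝ)]) 2 * (‖V !₂[q.1, q.2, (1 : ℝ)]‖ ^ 2 / 2 + Q !₂[q.1, q.2, (1 : ℝ)])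
        = F) :
    F = 0 := by
  -- `V = b` on the band
  have hVb : ∀ X : EuclideanSpace ℝ (Fin 3), 1 ≤ X 2 → X 2 ≤ 2 → V X = b := by
    intro X h1 h2
    refine (eq_of_forall_dist_le fun ε hε => ?_).symm
    obtain ⟨M, hM⟩ := hbd ε hε
    have := hM M le_rfl X h1 h2
    rw [hW] at this
    rwa [dist_eq_norm]
  have hpt2 : ∀ a c : ℝ, (!₂[a, c, (1 : ℝ)]) 2 = 1 := by intro a c; simp
  have hconst : ∀ q : ℝ × ℝ, V !₂[q.1, q.2, (1 : ℝ)] = b := fun q =>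
    hVb _ (by rw [hpt2]) (by rw [hpt2]; norm_num)
  simp_rw [hconst] at hmass hflux
  have hvol : (volume : Measure (ℝ × ℝ)).real (Set.Icc (0 : ℝ) 1 ×ˢ Set.Icc (0 : ℝ) 1) = 1 := by
    simp only [Measure.real]
    rw [Measure.volume_eq_prod, Measure.prod_prod, Real.volume_Icc]
    simp
  rw [setIntegral_const, hvol, one_smul] at hmass
  rw [hmass] at hflux
  simp at hflux
  exact hflux.symm

end DyadicWallCascadeNegative

open DyadicWallCascadeNegative in
/-- **`LiouvilleConjectureNS → ¬ ViscousWallProfile`** (negative lemma modulo the KNSS Liouville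
conjecture (L), for route `DyadicWallCascade`: the support stmt-AnomalousDissipation-17919 — which
is verbatim the antecedent of the crux `DyadicRealisation`, stmt-17918, and the conclusion of the
crux `ViscousContinuation`, stmt-17917 — is false modulo (L)).  Mechanism: the profile `W` is a
velocity-bounded smooth entire steady flow, hence (bridge) a bounded ancient mild solution, hence
constant modulo (L); a constant profile blows down to a band-constant field, whose zero mass flux
kills the energy flux: `F = 0`, contradicting the clause `F ≠ 0`.  Only the `W`-smoothness,
velocity bound, divergence and Navier–Stokes clauses, the `W`-half of the blow-down clause and the
two flux clauses are used (no mirror symmetry, no pressure bound, no Euler structure of `V`): the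
route lives exactly on the failure of the STEADY case of (L). [folklore] -/
theorem ViscousWallProfile_false_of_LiouvilleConjectureNS
    (hL : Summit.NavierStokesRegularity.NavierStokesRegularity.LiouvilleConjectureNS) :
    ¬ Summit.AnomalousDissipation.AnomalousDissipation.Theses.DyadicWallCascade.ViscousWallProfile := by
  rintro ⟨W, P, V, Q, C, F, C', hh⟩
  simp only at hh
  obtain ⟨⟨_, _, _, _, _, _, _, hmass, hF, hflux⟩, hWs, hPs, hWb, _, hWdiv, hNS, hbd⟩ := hh
  obtain ⟨b, hb⟩ := const_of_liouvilleConjectureNS hL hWs hPs (fun X => (hWb X).1) hWdiv hNS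
  refine hF (flux_eq_zero_of_const_blowdown (V := V) (Q := Q) hb (fun ε hε => ?_) hmass hflux)
  obtain ⟨M, hM⟩ := hbd ε hε
  exact ⟨M, fun m hm X h1 h2 => (hM m hm X h1 h2).1⟩

/-- **Any disproof of the crux `DyadicRealisation` (stmt-17918) refutes the KNSS Liouville
conjecture.**  `¬DyadicRealisation` unfolds to `ViscousWallProfile ∧ ¬SteadyZerothLaw`; the first
conjunct is impossible modulo (L) by `ViscousWallProfile_false_of_LiouvilleConjectureNS`.  (Why the
crux resists the disprover: a counterexample must contain a non-constant bounded entire steady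
Navier–Stokes flow — none is known — AND a proof that no smooth steady force on `T³` has loud
steady states along `ν → 0`, the negation of the summit-level item stmt-0219.) [folklore] -/
theorem LiouvilleConjectureNS_false_of_not_DyadicRealisation
    (hD : ¬ Summit.AnomalousDissipation.AnomalousDissipation.Theses.DyadicWallCascade.DyadicRealisation) :
    ¬ Summit.NavierStokesRegularity.NavierStokesRegularity.LiouvilleConjectureNS := fun hL =>
  hD fun hA => absurd hA (ViscousWallProfile_false_of_LiouvilleConjectureNS hL)

end Summit.AnomalousDissipation.AnomalousDissipation.Theorems
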